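import Summits.NavierStokesRegularity.FluidComputer.PalasekTowerRegisterGlobalLetterWitness
import Summits.NavierStokesRegularity.NavierStokesRegularity.Theses.PalasekTowerBreakdown

/-!
# `PalasekTowerBreakdown.HeredityAtOne`: the level-2 LETTER the first rung asks for is energetically
# free — the kinematic witness at `N₂ ≈ 820` by value

Cell `ns-blowup`, seat `ns-blowup-ecbridge-5` (g4); helper file for the first rung
stmt-NavierStokesRegularity-19249 `HeredityAtOne` (registered stubs `stub_continuation_envelope_one`
/ `stub_readout_floors_one`), the `k = 1` twin of `PalasekTowerBreakdownHeredityFromTwoLetterWitness`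
(p440971), reading `FluidComputer/PalasekTowerRegisterGlobalLetterWitness.lean` (p440747) BY NAME.
LABEL: E–C typing (kinematics + register arithmetic). WHAT THIS IS NOT: not Navier–Stokes evidence —
nothing here constructs a stage or a continuation; the rung is used only as a hypothesis or restated
as an equivalence; the witness is a time-slice field, not a flow.

* `palasekTowerBreakdown_heredityAtOne_iff_runs_letter`: the rung IS «every registered level-1 stage
  has a continuation that RUNS (classical on `[0, τ₂]`, agreeing on `[0, τ₁]`, finite energy, inside
  `c₂ Y₂`) whose slice at `τ₂` is a level-2 LETTER».
* `palasekTowerBreakdown_letterTwo_witness`: for every rigid schedule whose ball has radius `≥ 1/N₂`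
  the level-2 letter (velocity floor `Y₂`, strain floor `A₂`, a loop in a ball of radius `1/N₂` of
  speed `≤ 8π/N₂` with circulation `≥ N₂^{3/10}`) is carried INSIDE the ceiling `(5/3) Y₂` by a smooth
  divergence-free field confined to the ball, of energy `< 0.22`; BY VALUE the witness is a solid
  core of radius `< 1/1000` (`4/(5N₂)`, `N₂ > 820`) spinning at peak speed `(9/8) Y₂ ∈ (6906, 6908)`
  (ceiling `(5/3) Y₂ > 10231`) whose circle of radius `3/(4N₂)` carries circulation
  `(27π/16) N₂^{3/10} ∈ (39, 40)` (floor `N₂^{3/10} < 7.485`; Kelvin cap `8πc₂ N₂^{3/10} ≈ 313`).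
* `palasekTowerBreakdown_heredityAtOne_two_letters`: under the rung, at the hand-over `1 → 2` two
  fields meet the same level-2 letter inside the same ceiling — the extension's readout `s'.u τ₂`
  and the kinematic witness: the letter the rung demands pins no energy.

References: S. Palasek, arXiv:2605.13827 §3.1, §4 [cite: Palasek2026ElementaryModel, §4].
-/

noncomputable section

set_option linter.dupNamespace false

namespace Summit.NavierStokesRegularity.NavierStokesRegularity.Theorems

open Set MeasureTheory Filter Topology Function Real
open scoped ENNReal ContDiff NNReal
open Literature.Analysis.FluidPDE
open Summit.NavierStokesRegularity.FluidComputer.PalasekTowerClayBridge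

/-- **The first rung through the gate, by name**: `HeredityAtOne` ⇔ every globally anchored
registered level-1 stage of a pinned rigid quiet schedule has a continuation that `Runs` and carries
the level-2 `Letter` at `τ 2` (per stage: `Stage.exists_extends_iff_runs_letter`).
[cite: Palasek2026ElementaryModel, §4] -/
theorem palasekTowerBreakdown_heredityAtOne_iff_runs_letter :
    Theses.PalasekTowerBreakdown.HeredityAtOne ↔
      ∀ S : Schedule TowerRates.wide, S.Pins 8 (6 / 5) → S.Rigid → S.Quiet →
        ∀ s : Stage 1 TowerRates.wide S (Margins.routeG TowerRates.wide) 1,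
          ∃ (u : ℝ → EuclideanSpace ℝ (Fin 3) → EuclideanSpace ℝ (Fin 3))
            (p : ℝ → EuclideanSpace ℝ (Fin 3) → ℝ),
            Runs S 1 s u p ∧ Letter S 2 (u (S.τ 2)) :=
  ⟨fun h S hP hR hQ s => s.exists_extends_iff_runs_letter.1 (h S hP hR hQ s),
    fun h S hP hR hQ s => s.exists_extends_iff_runs_letter.2 (h S hP hR hQ s)⟩

/-- **The level-2 letter is energetically free, by value.** For every rigid schedule on the wide
rates with `1/N₂ ≤ radius` there is a `C^∞` divergence-free field `v` confined to the ball, inside the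
level-2 ceiling `c₂ Y₂`, with `Letter S 2 v`, energy `< 0.22`, and the numbers of the witness:
support radius `4/(5N₂) < 1/1000`, peak speed `(9/8) Y₂ ∈ (6906, 6908)` attained at `(3/(4N₂)) e₀`,
circulation of the circle of radius `3/(4N₂)` equal to `(27π/16) N₂^{β-2} ∈ (39, 40)`.
[cite: Palasek2026ElementaryModel, §3.1] -/
theorem palasekTowerBreakdown_letterTwo_witness {S : Schedule TowerRates.wide} (hS : S.Rigid)
    (hrad : 1 / TowerRates.wide.N 2 ≤ S.radius) :
    ∃ v : EuclideanSpace ℝ (Fin 3) → EuclideanSpace ℝ (Fin 3),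
      ContDiff ℝ ∞ v ∧ VectorCalculus.IsDivFree v ∧
      (∀ y, S.radius < ‖y‖ → v y = 0) ∧
      (∀ y, ‖v y‖ ≤ S.c₂ * TowerRates.wide.Y 2) ∧
      Letter S 2 v ∧
      ∫⁻ y, ‖v y‖ₑ ^ 2 ≤ ENNReal.ofReal (22 / 100) ∧
      (∀ y, 1 / 1000 ≤ ‖y‖ → v y = 0) ∧
      6906 < ‖v ((3 / (4 * TowerRates.wide.N 2)) • EuclideanSpace.single 0 1)‖ ∧
      ‖v ((3 / (4 * TowerRates.wide.N 2)) • EuclideanSpace.single 0 1)‖ < 6908 ∧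
      39 < circulation v (circleLoop 0 (3 / (4 * TowerRates.wide.N 2)) (EuclideanSpace.single 0 1)
          (EuclideanSpace.single 1 1)) ∧
      circulation v (circleLoop 0 (3 / (4 * TowerRates.wide.N 2)) (EuclideanSpace.single 0 1)
          (EuclideanSpace.single 1 1)) < 40 := by
  have hN := TowerRates.wide_N_two_bounds
  have hY := TowerRates.wide_Y_two_bounds
  have hR := TowerRates.wide_N_two_rpow_bounds
  have hNpos : 0 < TowerRates.wide.N 2 := TowerRates.wide.N_pos 2
  obtain ⟨v, hsm, hdiv, hsupp, hceil, hvel, hstr, ⟨hC1, hcl, hball, hspd, hcirc⟩, hE⟩ :=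
    exists_letterWitness TowerRates.wide 2 (0 : EuclideanSpace ℝ (Fin 3))
  have hc : ‖(0 : EuclideanSpace ℝ (Fin 3))‖ + 1 / TowerRates.wide.N 2 ≤ S.radius := by
    simpa using hrad
  have hrad0 : (0 : ℝ) ≤ S.radius := le_trans (by positivity) hrad
  refine ⟨v, hsm, hdiv, ?_, ?_, ⟨?_, ?_, ?_⟩, ?_, ?_, ?_, ?_, ?_, ?_⟩
  · -- confinement to the ball
    intro y hy
    apply hsupp
    rw [sub_zero]
    have h2 : 4 / (5 * TowerRates.wide.N 2) ≤ 1 / TowerRates.wide.N 2 := by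
      rw [div_le_div_iff₀ (by positivity) hNpos]; linarith
    linarith
  · -- the level-2 ceiling
    intro y
    refine (hceil y).trans ?_
    rw [hS.c₂_eq]
    nlinarith
  · -- velocity floor `c₁ Y₂`
    refine ⟨(3 / (4 * TowerRates.wide.N 2)) • EuclideanSpace.single 0 1, ?_, ?_⟩
    · have h1 : ‖(3 / (4 * TowerRates.wide.N 2)) • EuclideanSpace.single (0 : Fin 3) (1 : ℝ)‖ =
          3 / (4 * TowerRates.wide.N 2) := by
        rw [norm_smul, Real.norm_eq_abs, abs_of_pos (by positivity)]
        simp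
      have h2 : 3 / (4 * TowerRates.wide.N 2) ≤ 1 / TowerRates.wide.N 2 := by
        rw [div_le_div_iff₀ (by positivity) hNpos]; linarith
      rw [h1]; linarith
    · rw [zero_add] at hvel
      rw [hvel, hS.c₁_eq]; nlinarith
  · -- strain floor `c₁ A₂`
    exact ⟨0, by simpa using hrad0, by rw [hS.c₁_eq]; nlinarith [TowerRates.wide.A_pos 2]⟩
  · -- core loop of level 2
    refine ⟨0, circleLoop 0 (3 / (4 * TowerRates.wide.N 2)) (EuclideanSpace.single 0 1)
      (EuclideanSpace.single 1 1), by simpa using hrad0, hC1, hcl, hball, hspd, ?_⟩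
    rw [hcirc, hS.c₁_eq, one_mul]
    nlinarith [Real.pi_gt_three, hR.1]
  · -- energy `< 0.22`
    refine hE.trans (ENNReal.ofReal_le_ofReal ?_)
    rw [TowerRates.wide.Y_sq_div_N_cube 2]
    have h := wide_letter_energy_lt (m := 2) le_rfl
    have hβ : 2 * TowerRates.wide.β - 5 = -(2 / 5 : ℝ) := by simp only [TowerRates.wide]; norm_num
    rw [hβ]
    norm_num at h ⊢
    exact h.le
  · -- support radius `< 1/1000`
    intro y hy
    apply hsupp
    rw [sub_zero]
    have h2 : 4 / (5 * TowerRates.wide.N 2) ≤ 1 / 1000 := by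
      rw [div_le_div_iff₀ (by positivity) (by norm_num)]; linarith [hN.1]
    linarith
  · -- peak speed `> 6906`
    rw [zero_add] at hvel
    rw [hvel]; linarith [hY.1]
  · rw [zero_add] at hvel
    rw [hvel]; linarith [hY.2]
  · -- circulation `∈ (39, 40)`
    rw [hcirc]; nlinarith [Real.pi_gt_d2, hR.1]
  · rw [hcirc]; nlinarith [Real.pi_lt_d2, hR.2]

/-- **Under the first rung, two letters at the hand-over `1 → 2`**: the extension stage's own readout
`s'.u (τ 2)` and the kinematic witness confined to the ball, both inside the ceiling `c₂ Y₂`, the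
witness with energy `< 0.22` — the level-2 letter demanded by `HeredityAtOne` carries no energy floor.
[cite: Palasek2026ElementaryModel, §4] -/
theorem palasekTowerBreakdown_heredityAtOne_two_letters
    (h : Theses.PalasekTowerBreakdown.HeredityAtOne)
    {S : Schedule TowerRates.wide} (hP : S.Pins 8 (6 / 5)) (hR : S.Rigid) (hQ : S.Quiet)
    (s : Stage 1 TowerRates.wide S (Margins.routeG TowerRates.wide) 1)
    (hrad : 1 / TowerRates.wide.N 2 ≤ S.radius) :
    ∃ (s' : Stage 1 TowerRates.wide S (Margins.routeG TowerRates.wide) 2)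
      (v : EuclideanSpace ℝ (Fin 3) → EuclideanSpace ℝ (Fin 3)),
      s.Extends s' ∧ Letter S 2 (s'.u (S.τ 2)) ∧
      (∀ t ∈ Icc 0 (S.τ 2), ∀ y, ‖s'.u t y‖ ≤ S.c₂ * TowerRates.wide.Y 2) ∧
      ContDiff ℝ ∞ v ∧ VectorCalculus.IsDivFree v ∧ (∀ y, S.radius < ‖y‖ → v y = 0) ∧
      (∀ y, ‖v y‖ ≤ S.c₂ * TowerRates.wide.Y 2) ∧ Letter S 2 v ∧
      ∫⁻ y, ‖v y‖ₑ ^ 2 ≤ ENNReal.ofReal (22 / 100) := by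
  obtain ⟨s', hs'⟩ := h S hP hR hQ s
  obtain ⟨v, hsm, hdiv, hsupp, hceil, hletter, hE, -⟩ := palasekTowerBreakdown_letterTwo_witness hR hrad
  exact ⟨s', v, hs', Letter.of_stage s' le_rfl, fun t ht y => s'.ceiling 2 le_rfl t ht y,
    hsm, hdiv, hsupp, hceil, hletter, hE⟩

end Summit.NavierStokesRegularity.NavierStokesRegularity.Theorems

end
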